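/-
Copyright: harness cell b2b-lgcu-borel (gen 26).  Honest framing: the VALUE here is a THEOREM
(a decidable NEGATIVE verdict on an infinite slice of the crux: all subgroup triples of
`GL_3(𝔽_p)`, `p ∈ {59, 61, 67, 71}`, below an explicit `ε`) — NOT summit progress; the crux item
`SubgroupIdentityDesigns` (stmt-MatrixMultiplication-14079) stays open and untouched.
-/
import Mathlib
import Literature.Barriers.RiemannHypothesis.EpsteinZetaRealZerosIntegralWitness
import Summits.MatrixMultiplication.MatrixMultiplication.Theorems.SubgroupIdentityDesigns.Negative.LevelOneEpsilonFloor

/-!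
# The `ε`-window of the level-one cells `(m, p) = (3, 59), (3, 61), (3, 67), (3, 71)`

Route `LevelGradedCohnUmans`, crux `SubgroupIdentityDesigns`, negative side; level `k = 1`.
Fourth file of the series `LevelOneEpsilonCells` (`p = 11, 13, 17, 19`), `LevelOneEpsilonCellsTwo`
(`p = 23, 29, 31, 37`), `LevelOneEpsilonCellsThree` (`p = 41, 43, 47, 53`); same mechanism: the general-exponent floor
`LevelOneEpsilonFloor.floor_exp` against the volume law of `WitnessNeumannCounts.crux_volume_law`.

* `cert_fiftynine`, …, `cert_seventyone` : pure arithmetic certificates by `norm_num` (generated and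
  checked exactly by `code/g26/lean/gen_cells4.py`);
* `no_levelOne_witness_three_fiftynine` / `_sixtyone` / `_sixtyseven` / `_seventyone` : **at
  `(m, p) = (3, 59), (3, 61), (3, 67), (3, 71)` NO subgroup-TPP triple with a level-one identity
  design satisfies the crux inequality for ANY `−2 < ε ≤ 1/3`** (`t = 7/3`; base margins about
  6.8 %, 6.2 %, 4.5 %, 3.5 %);
* `no_crux_instance_three_fiftynine_sixtyone`, `no_crux_instance_three_sixtyseven_seventyone` :
  the crux clause verbatim at `m = 3`.

So these cells are open only in the window `ε ∈ (1/3, 1]`; with the three earlier files every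
prime `11 ≤ p ≤ 71` now has a certified `ε`-window at `m = 3`, `k = 1`.
Sorry-free; standard axioms; no new definitions.  Report:
`run/shared/lean/b2b/levelgraded-cu/ORACLE-g26.md` §G26-2.
-/

set_option linter.dupNamespace false

noncomputable section

open scoped BigOperators Classical Matrix
open Module (finrank)

namespace Summit.MatrixMultiplication.MatrixMultiplication.Theorems.SubgroupIdentityDesigns.Negative
namespace LevelOneEpsilonCellsFour

open Literature.Barriers.MatrixMultiplication (SubgroupTPP)
open Summit.MatrixMultiplication.MatrixMultiplication.Theorems.LieRankDesigns.Negative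
  (GLm Mat budget)
open Summit.MatrixMultiplication.MatrixMultiplication.Theorems.LevelOneGL2Designs.Negative
  (levelSubmodule)
open LevelOneFloorAll (finrank_le_formula_nat)
open WitnessNeumannCounts (crux_volume_law)
open LevelOneEpsilonFloor (floor_exp volume_cap quad_trichotomy volume_real cell_absurd)
-- root comparisons `c^n ≤ x^k ⇒ c ≤ x^{k/n}` (generic real-analysis helpers already in the tree)
open Literature.Barriers.RiemannHypothesis (le_rpow_of_pow_le rpow_le_of_pow_le)

variable {p : ℕ} [hp : Fact p.Prime]

/-! ## The cells `(3, 59)`, `(3, 61)`, `(3, 67)`, `(3, 71)`: no witness unless `ε > 1/3` -/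

/-- Arithmetic certificate of the cell `(3, 59)`: `D ≤ 727236418`, volume cap `V ≤ 7548757760160`
(`u = 15570`), floor exponent `t = 7/3`: `190988673 ≤ 3540^t`, `191114583 ≤ 3541^t`,
`7548757760160^(t/3) ≤ 11084519905`. -/
theorem cert_fiftynine {u D V : ℕ} (hu1 : 1 ≤ u) (hvol : V + u * u * (u - 1) ≤ u * D)
    (hD : D + 2 * 3541 ≤ (59 - 1) * 3541 ^ 2 + 2)
    (hfl : 1 + (((3541 : ℕ) : ℝ) - 1) ^ ((7 : ℝ) / 3) +
      (((59 : ℕ) : ℝ) - 2) * ((3541 : ℕ) : ℝ) ^ ((7 : ℝ) / 3) <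
      ((V : ℕ) : ℝ) ^ ((7 : ℝ) / 3 / 3)) : False := by
  have hDm : D ≤ 727236418 := by norm_num at hD; omega
  obtain ⟨w, hw⟩ := volume_real hu1 hvol hDm
  have hw0 : (0 : ℝ) ≤ w := Nat.cast_nonneg _
  have hq := quad_trichotomy (w := w) (w₀ := 15569) (D := ((727236418 : ℕ) : ℝ)) (by norm_num)
    (by norm_num)
  have hcap := volume_cap (w₀ := ((15569 : ℕ) : ℝ)) hw0 hw le_rfl hq
  have hVM : ((V : ℕ) : ℝ) ≤ 7548757760160 := by norm_num at hcap; exact_mod_cast hcap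
  have e1 : (((3541 : ℕ) : ℝ) - 1) = 3540 := by norm_num
  have e2 : (((59 : ℕ) : ℝ) - 2) = 57 := by norm_num
  have e3 : (((3541 : ℕ) : ℝ)) = 3541 := by norm_num
  have e4 : ((7 : ℝ) / 3 / 3) = (7 : ℝ) / 9 := by norm_num
  rw [e1, e2, e3, e4] at hfl
  have h2 : (190988673 : ℝ) ≤ (3540 : ℝ) ^ ((7 : ℝ) / 3) :=
    le_rpow_of_pow_le (k := 7) (n := 3) (by norm_num) (by norm_num) (by norm_num)
      (by norm_num) (by norm_num)
  have h1 : (191114583 : ℝ) ≤ (3541 : ℝ) ^ ((7 : ℝ) / 3) :=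
    le_rpow_of_pow_le (k := 7) (n := 3) (by norm_num) (by norm_num) (by norm_num)
      (by norm_num) (by norm_num)
  have hM : (7548757760160 : ℝ) ^ ((7 : ℝ) / 9) ≤ 1 + 190988673 + 57 * 191114583 :=
    rpow_le_of_pow_le (k := 7) (n := 9) (by norm_num) (by norm_num) (by norm_num)
      (by norm_num) (by norm_num)
  exact cell_absurd (Nat.cast_nonneg V) hVM (by norm_num) (by norm_num) hfl h2 h1 hM

/-- **NO LEVEL-ONE WITNESS AT `(m, p) = (3, 59)` FOR `−2 < ε ≤ 1/3`** (all subgroup triples; TPP and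
a level-one identity design only feed the volume law). -/
theorem no_levelOne_witness_three_fiftynine (hp' : p = 59) {ε : ℝ} (hε : -2 < ε) (hε1 : ε ≤ 1 / 3)
    {H₁ H₂ H₃ : Subgroup (GLm p (1 + 2))} (htpp : SubgroupTPP H₁ H₂ H₃)
    (hdes : ∃ c : Mat p (1 + 2) → ℂ, (∀ M, 1 < M.rank → c M = 0) ∧
      (∑ M, c M * ZMod.stdAddChar (Matrix.trace (M * ((1 : GLm p (1 + 2)) : Mat p (1 + 2))))) = 1 ∧
      ∀ a ∈ H₁, ∀ b ∈ H₂, ∀ g ∈ H₃, a * b * g ≠ 1 →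
        (∑ M, c M * ZMod.stdAddChar
          (Matrix.trace (M * ((a * b * g : GLm p (1 + 2)) : Mat p (1 + 2))))) = 0) :
    ¬ budget p (1 + 2) 1 (2 + ε) <
      ((Nat.card H₁ * Nat.card H₂ * Nat.card H₃ : ℕ) : ℝ) ^ ((2 + ε) / 3) := by
  intro hlt
  subst hp'
  obtain ⟨u, hu1, -, -, -, -, hvol⟩ := crux_volume_law (k := 1) htpp hdes
  have hfl := floor_exp (p := 59) (l := 2) (t := (7 : ℝ) / 3) (by omega) hε (by linarith) hlt
  have hD := finrank_le_formula_nat (p := 59) (l := 2)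
  have hb : (59 ^ (1 + 2) - 1) / (59 - 1) = 3541 := by norm_num
  rw [hb] at hfl hD
  generalize finrank ℂ (levelSubmodule 59 (1 + 2) 1) = D at hD hvol
  generalize Nat.card H₁ * Nat.card H₂ * Nat.card H₃ = V at hfl hvol
  exact cert_fiftynine hu1 hvol hD hfl

/-- Arithmetic certificate of the cell `(3, 61)`: `D ≤ 858657776`, volume cap `V ≤ 9684810100460`
(`u = 16918`), floor exponent `t = 7/3`: `222852181 ≤ 3782^t`, `222989696 ≤ 3783^t`,
`9684810100460^(t/3) ≤ 13379244246`. -/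
theorem cert_sixtyone {u D V : ℕ} (hu1 : 1 ≤ u) (hvol : V + u * u * (u - 1) ≤ u * D)
    (hD : D + 2 * 3783 ≤ (61 - 1) * 3783 ^ 2 + 2)
    (hfl : 1 + (((3783 : ℕ) : ℝ) - 1) ^ ((7 : ℝ) / 3) +
      (((61 : ℕ) : ℝ) - 2) * ((3783 : ℕ) : ℝ) ^ ((7 : ℝ) / 3) <
      ((V : ℕ) : ℝ) ^ ((7 : ℝ) / 3 / 3)) : False := by
  have hDm : D ≤ 858657776 := by norm_num at hD; omega
  obtain ⟨w, hw⟩ := volume_real hu1 hvol hDm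
  have hw0 : (0 : ℝ) ≤ w := Nat.cast_nonneg _
  have hq := quad_trichotomy (w := w) (w₀ := 16917) (D := ((858657776 : ℕ) : ℝ)) (by norm_num)
    (by norm_num)
  have hcap := volume_cap (w₀ := ((16917 : ℕ) : ℝ)) hw0 hw le_rfl hq
  have hVM : ((V : ℕ) : ℝ) ≤ 9684810100460 := by norm_num at hcap; exact_mod_cast hcap
  have e1 : (((3783 : ℕ) : ℝ) - 1) = 3782 := by norm_num
  have e2 : (((61 : ℕ) : ℝ) - 2) = 59 := by norm_num
  have e3 : (((3783 : ℕ) : ℝ)) = 3783 := by norm_num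
  have e4 : ((7 : ℝ) / 3 / 3) = (7 : ℝ) / 9 := by norm_num
  rw [e1, e2, e3, e4] at hfl
  have h2 : (222852181 : ℝ) ≤ (3782 : ℝ) ^ ((7 : ℝ) / 3) :=
    le_rpow_of_pow_le (k := 7) (n := 3) (by norm_num) (by norm_num) (by norm_num)
      (by norm_num) (by norm_num)
  have h1 : (222989696 : ℝ) ≤ (3783 : ℝ) ^ ((7 : ℝ) / 3) :=
    le_rpow_of_pow_le (k := 7) (n := 3) (by norm_num) (by norm_num) (by norm_num)
      (by norm_num) (by norm_num)
  have hM : (9684810100460 : ℝ) ^ ((7 : ℝ) / 9) ≤ 1 + 222852181 + 59 * 222989696 :=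
    rpow_le_of_pow_le (k := 7) (n := 9) (by norm_num) (by norm_num) (by norm_num)
      (by norm_num) (by norm_num)
  exact cell_absurd (Nat.cast_nonneg V) hVM (by norm_num) (by norm_num) hfl h2 h1 hM

/-- **NO LEVEL-ONE WITNESS AT `(m, p) = (3, 61)` FOR `−2 < ε ≤ 1/3`** (all subgroup triples; TPP and
a level-one identity design only feed the volume law). -/
theorem no_levelOne_witness_three_sixtyone (hp' : p = 61) {ε : ℝ} (hε : -2 < ε) (hε1 : ε ≤ 1 / 3)
    {H₁ H₂ H₃ : Subgroup (GLm p (1 + 2))} (htpp : SubgroupTPP H₁ H₂ H₃)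
    (hdes : ∃ c : Mat p (1 + 2) → ℂ, (∀ M, 1 < M.rank → c M = 0) ∧
      (∑ M, c M * ZMod.stdAddChar (Matrix.trace (M * ((1 : GLm p (1 + 2)) : Mat p (1 + 2))))) = 1 ∧
      ∀ a ∈ H₁, ∀ b ∈ H₂, ∀ g ∈ H₃, a * b * g ≠ 1 →
        (∑ M, c M * ZMod.stdAddChar
          (Matrix.trace (M * ((a * b * g : GLm p (1 + 2)) : Mat p (1 + 2))))) = 0) :
    ¬ budget p (1 + 2) 1 (2 + ε) <
      ((Nat.card H₁ * Nat.card H₂ * Nat.card H₃ : ℕ) : ℝ) ^ ((2 + ε) / 3) := by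
  intro hlt
  subst hp'
  obtain ⟨u, hu1, -, -, -, -, hvol⟩ := crux_volume_law (k := 1) htpp hdes
  have hfl := floor_exp (p := 61) (l := 2) (t := (7 : ℝ) / 3) (by omega) hε (by linarith) hlt
  have hD := finrank_le_formula_nat (p := 61) (l := 2)
  have hb : (61 ^ (1 + 2) - 1) / (61 - 1) = 3783 := by norm_num
  rw [hb] at hfl hD
  generalize finrank ℂ (levelSubmodule 61 (1 + 2) 1) = D at hD hvol
  generalize Nat.card H₁ * Nat.card H₂ * Nat.card H₃ = V at hfl hvol
  exact cert_sixtyone hu1 hvol hD hfl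

/-- Arithmetic certificate of the cell `(3, 67)`: `D ≤ 1370563322`, volume cap `V ≤ 19530210790680`
(`u = 21374`), floor exponent `t = 7/3`: `344108448 ≤ 4556^t`, `344284708 ≤ 4557^t`,
`19530210790680^(t/3) ≤ 22722614469`. -/
theorem cert_sixtyseven {u D V : ℕ} (hu1 : 1 ≤ u) (hvol : V + u * u * (u - 1) ≤ u * D)
    (hD : D + 2 * 4557 ≤ (67 - 1) * 4557 ^ 2 + 2)
    (hfl : 1 + (((4557 : ℕ) : ℝ) - 1) ^ ((7 : ℝ) / 3) +
      (((67 : ℕ) : ℝ) - 2) * ((4557 : ℕ) : ℝ) ^ ((7 : ℝ) / 3) <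
      ((V : ℕ) : ℝ) ^ ((7 : ℝ) / 3 / 3)) : False := by
  have hDm : D ≤ 1370563322 := by norm_num at hD; omega
  obtain ⟨w, hw⟩ := volume_real hu1 hvol hDm
  have hw0 : (0 : ℝ) ≤ w := Nat.cast_nonneg _
  have hq := quad_trichotomy (w := w) (w₀ := 21373) (D := ((1370563322 : ℕ) : ℝ)) (by norm_num)
    (by norm_num)
  have hcap := volume_cap (w₀ := ((21373 : ℕ) : ℝ)) hw0 hw le_rfl hq
  have hVM : ((V : ℕ) : ℝ) ≤ 19530210790680 := by norm_num at hcap; exact_mod_cast hcap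
  have e1 : (((4557 : ℕ) : ℝ) - 1) = 4556 := by norm_num
  have e2 : (((67 : ℕ) : ℝ) - 2) = 65 := by norm_num
  have e3 : (((4557 : ℕ) : ℝ)) = 4557 := by norm_num
  have e4 : ((7 : ℝ) / 3 / 3) = (7 : ℝ) / 9 := by norm_num
  rw [e1, e2, e3, e4] at hfl
  have h2 : (344108448 : ℝ) ≤ (4556 : ℝ) ^ ((7 : ℝ) / 3) :=
    le_rpow_of_pow_le (k := 7) (n := 3) (by norm_num) (by norm_num) (by norm_num)
      (by norm_num) (by norm_num)
  have h1 : (344284708 : ℝ) ≤ (4557 : ℝ) ^ ((7 : ℝ) / 3) :=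
    le_rpow_of_pow_le (k := 7) (n := 3) (by norm_num) (by norm_num) (by norm_num)
      (by norm_num) (by norm_num)
  have hM : (19530210790680 : ℝ) ^ ((7 : ℝ) / 9) ≤ 1 + 344108448 + 65 * 344284708 :=
    rpow_le_of_pow_le (k := 7) (n := 9) (by norm_num) (by norm_num) (by norm_num)
      (by norm_num) (by norm_num)
  exact cell_absurd (Nat.cast_nonneg V) hVM (by norm_num) (by norm_num) hfl h2 h1 hM

/-- **NO LEVEL-ONE WITNESS AT `(m, p) = (3, 67)` FOR `−2 < ε ≤ 1/3`** (all subgroup triples; TPP and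
a level-one identity design only feed the volume law). -/
theorem no_levelOne_witness_three_sixtyseven (hp' : p = 67) {ε : ℝ} (hε : -2 < ε) (hε1 : ε ≤ 1 / 3)
    {H₁ H₂ H₃ : Subgroup (GLm p (1 + 2))} (htpp : SubgroupTPP H₁ H₂ H₃)
    (hdes : ∃ c : Mat p (1 + 2) → ℂ, (∀ M, 1 < M.rank → c M = 0) ∧
      (∑ M, c M * ZMod.stdAddChar (Matrix.trace (M * ((1 : GLm p (1 + 2)) : Mat p (1 + 2))))) = 1 ∧
      ∀ a ∈ H₁, ∀ b ∈ H₂, ∀ g ∈ H₃, a * b * g ≠ 1 →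
        (∑ M, c M * ZMod.stdAddChar
          (Matrix.trace (M * ((a * b * g : GLm p (1 + 2)) : Mat p (1 + 2))))) = 0) :
    ¬ budget p (1 + 2) 1 (2 + ε) <
      ((Nat.card H₁ * Nat.card H₂ * Nat.card H₃ : ℕ) : ℝ) ^ ((2 + ε) / 3) := by
  intro hlt
  subst hp'
  obtain ⟨u, hu1, -, -, -, -, hvol⟩ := crux_volume_law (k := 1) htpp hdes
  have hfl := floor_exp (p := 67) (l := 2) (t := (7 : ℝ) / 3) (by omega) hε (by linarith) hlt
  have hD := finrank_le_formula_nat (p := 67) (l := 2)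
  have hb : (67 ^ (1 + 2) - 1) / (67 - 1) = 4557 := by norm_num
  rw [hb] at hfl hD
  generalize finrank ℂ (levelSubmodule 67 (1 + 2) 1) = D at hD hvol
  generalize Nat.card H₁ * Nat.card H₂ * Nat.card H₃ = V at hfl hvol
  exact cert_sixtyseven hu1 hvol hD hfl

/-- Arithmetic certificate of the cell `(3, 71)`: `D ≤ 1829983606`, volume cap `V ≤ 30131982335800`
(`u = 24698`), floor exponent `t = 7/3`: `450172165 ≤ 5112^t`, `450377669 ≤ 5113^t`,
`30131982335800^(t/3) ≤ 31526231327`. -/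
theorem cert_seventyone {u D V : ℕ} (hu1 : 1 ≤ u) (hvol : V + u * u * (u - 1) ≤ u * D)
    (hD : D + 2 * 5113 ≤ (71 - 1) * 5113 ^ 2 + 2)
    (hfl : 1 + (((5113 : ℕ) : ℝ) - 1) ^ ((7 : ℝ) / 3) +
      (((71 : ℕ) : ℝ) - 2) * ((5113 : ℕ) : ℝ) ^ ((7 : ℝ) / 3) <
      ((V : ℕ) : ℝ) ^ ((7 : ℝ) / 3 / 3)) : False := by
  have hDm : D ≤ 1829983606 := by norm_num at hD; omega
  obtain ⟨w, hw⟩ := volume_real hu1 hvol hDm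
  have hw0 : (0 : ℝ) ≤ w := Nat.cast_nonneg _
  have hq := quad_trichotomy (w := w) (w₀ := 24697) (D := ((1829983606 : ℕ) : ℝ)) (by norm_num)
    (by norm_num)
  have hcap := volume_cap (w₀ := ((24697 : ℕ) : ℝ)) hw0 hw le_rfl hq
  have hVM : ((V : ℕ) : ℝ) ≤ 30131982335800 := by norm_num at hcap; exact_mod_cast hcap
  have e1 : (((5113 : ℕ) : ℝ) - 1) = 5112 := by norm_num
  have e2 : (((71 : ℕ) : ℝ) - 2) = 69 := by norm_num
  have e3 : (((5113 : ℕ) : ℝ)) = 5113 := by norm_num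
  have e4 : ((7 : ℝ) / 3 / 3) = (7 : ℝ) / 9 := by norm_num
  rw [e1, e2, e3, e4] at hfl
  have h2 : (450172165 : ℝ) ≤ (5112 : ℝ) ^ ((7 : ℝ) / 3) :=
    le_rpow_of_pow_le (k := 7) (n := 3) (by norm_num) (by norm_num) (by norm_num)
      (by norm_num) (by norm_num)
  have h1 : (450377669 : ℝ) ≤ (5113 : ℝ) ^ ((7 : ℝ) / 3) :=
    le_rpow_of_pow_le (k := 7) (n := 3) (by norm_num) (by norm_num) (by norm_num)
      (by norm_num) (by norm_num)
  have hM : (30131982335800 : ℝ) ^ ((7 : ℝ) / 9) ≤ 1 + 450172165 + 69 * 450377669 :=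
    rpow_le_of_pow_le (k := 7) (n := 9) (by norm_num) (by norm_num) (by norm_num)
      (by norm_num) (by norm_num)
  exact cell_absurd (Nat.cast_nonneg V) hVM (by norm_num) (by norm_num) hfl h2 h1 hM

/-- **NO LEVEL-ONE WITNESS AT `(m, p) = (3, 71)` FOR `−2 < ε ≤ 1/3`** (all subgroup triples; TPP and
a level-one identity design only feed the volume law). -/
theorem no_levelOne_witness_three_seventyone (hp' : p = 71) {ε : ℝ} (hε : -2 < ε) (hε1 : ε ≤ 1 / 3)
    {H₁ H₂ H₃ : Subgroup (GLm p (1 + 2))} (htpp : SubgroupTPP H₁ H₂ H₃)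
    (hdes : ∃ c : Mat p (1 + 2) → ℂ, (∀ M, 1 < M.rank → c M = 0) ∧
      (∑ M, c M * ZMod.stdAddChar (Matrix.trace (M * ((1 : GLm p (1 + 2)) : Mat p (1 + 2))))) = 1 ∧
      ∀ a ∈ H₁, ∀ b ∈ H₂, ∀ g ∈ H₃, a * b * g ≠ 1 →
        (∑ M, c M * ZMod.stdAddChar
          (Matrix.trace (M * ((a * b * g : GLm p (1 + 2)) : Mat p (1 + 2))))) = 0) :
    ¬ budget p (1 + 2) 1 (2 + ε) <
      ((Nat.card H₁ * Nat.card H₂ * Nat.card H₃ : ℕ) : ℝ) ^ ((2 + ε) / 3) := by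
  intro hlt
  subst hp'
  obtain ⟨u, hu1, -, -, -, -, hvol⟩ := crux_volume_law (k := 1) htpp hdes
  have hfl := floor_exp (p := 71) (l := 2) (t := (7 : ℝ) / 3) (by omega) hε (by linarith) hlt
  have hD := finrank_le_formula_nat (p := 71) (l := 2)
  have hb : (71 ^ (1 + 2) - 1) / (71 - 1) = 5113 := by norm_num
  rw [hb] at hfl hD
  generalize finrank ℂ (levelSubmodule 71 (1 + 2) 1) = D at hD hvol
  generalize Nat.card H₁ * Nat.card H₂ * Nat.card H₃ = V at hfl hvol
  exact cert_seventyone hu1 hvol hD hfl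

/-! ## The crux clause verbatim at `m = 3` -/

/-- **The crux clause verbatim has no level-one instance at `(m, p) = (3, 59)` or `(3, 61)` for
any `−2 < ε ≤ 1/3`** — the cells are open only in the window `ε ∈ (1/3, 1]`. -/
theorem no_crux_instance_three_fiftynine_sixtyone (hp' : p = 59 ∨ p = 61) {ε : ℝ}
    (hε : -2 < ε) (hε1 : ε ≤ 1 / 3) :
    ¬ ∃ (H₁ H₂ H₃ : Subgroup (Matrix.GeneralLinearGroup (Fin 3) (ZMod p))),
      Literature.Barriers.MatrixMultiplication.SubgroupTPP H₁ H₂ H₃ ∧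
      (∃ c : Matrix (Fin 3) (Fin 3) (ZMod p) → ℂ, (∀ M, 1 < M.rank → c M = 0) ∧
        (∑ M : Matrix (Fin 3) (Fin 3) (ZMod p), c M * ZMod.stdAddChar
          (Matrix.trace (M * ((1 : Matrix.GeneralLinearGroup (Fin 3) (ZMod p)) :
            Matrix (Fin 3) (Fin 3) (ZMod p))))) = 1 ∧
        ∀ a ∈ H₁, ∀ b ∈ H₂, ∀ g ∈ H₃, a * b * g ≠ 1 →
          (∑ M : Matrix (Fin 3) (Fin 3) (ZMod p), c M * ZMod.stdAddChar
            (Matrix.trace (M * ((a * b * g : Matrix.GeneralLinearGroup (Fin 3) (ZMod p)) :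
              Matrix (Fin 3) (Fin 3) (ZMod p))))) = 0) ∧
      (∑ᶠ χ ∈ Literature.RepresentationTheory.FiniteGroups.irrChars
          (Matrix.GeneralLinearGroup (Fin 3) (ZMod p)) ∩
          {f | ∃ c : Matrix (Fin 3) (Fin 3) (ZMod p) → ℂ, (∀ M, 1 < M.rank → c M = 0) ∧
            ∀ g : Matrix.GeneralLinearGroup (Fin 3) (ZMod p), f g =
              ∑ M : Matrix (Fin 3) (Fin 3) (ZMod p), c M * ZMod.stdAddChar
                (Matrix.trace (M * (g : Matrix (Fin 3) (Fin 3) (ZMod p))))},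
        (χ 1).re ^ (2 + ε)) <
        ((Nat.card H₁ * Nat.card H₂ * Nat.card H₃ : ℕ) : ℝ) ^ ((2 + ε) / 3) := by
  rintro ⟨H₁, H₂, H₃, htpp, hdesign, hlt⟩
  rcases hp' with h | h
  · exact no_levelOne_witness_three_fiftynine h hε hε1 htpp hdesign hlt
  · exact no_levelOne_witness_three_sixtyone h hε hε1 htpp hdesign hlt

/-- **The crux clause verbatim has no level-one instance at `(m, p) = (3, 67)` or `(3, 71)` for
any `−2 < ε ≤ 1/3`.** -/
theorem no_crux_instance_three_sixtyseven_seventyone (hp' : p = 67 ∨ p = 71) {ε : ℝ}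
    (hε : -2 < ε) (hε1 : ε ≤ 1 / 3) :
    ¬ ∃ (H₁ H₂ H₃ : Subgroup (Matrix.GeneralLinearGroup (Fin 3) (ZMod p))),
      Literature.Barriers.MatrixMultiplication.SubgroupTPP H₁ H₂ H₃ ∧
      (∃ c : Matrix (Fin 3) (Fin 3) (ZMod p) → ℂ, (∀ M, 1 < M.rank → c M = 0) ∧
        (∑ M : Matrix (Fin 3) (Fin 3) (ZMod p), c M * ZMod.stdAddChar
          (Matrix.trace (M * ((1 : Matrix.GeneralLinearGroup (Fin 3) (ZMod p)) :
            Matrix (Fin 3) (Fin 3) (ZMod p))))) = 1 ∧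
        ∀ a ∈ H₁, ∀ b ∈ H₂, ∀ g ∈ H₃, a * b * g ≠ 1 →
          (∑ M : Matrix (Fin 3) (Fin 3) (ZMod p), c M * ZMod.stdAddChar
            (Matrix.trace (M * ((a * b * g : Matrix.GeneralLinearGroup (Fin 3) (ZMod p)) :
              Matrix (Fin 3) (Fin 3) (ZMod p))))) = 0) ∧
      (∑ᶠ χ ∈ Literature.RepresentationTheory.FiniteGroups.irrChars
          (Matrix.GeneralLinearGroup (Fin 3) (ZMod p)) ∩
          {f | ∃ c : Matrix (Fin 3) (Fin 3) (ZMod p) → ℂ, (∀ M, 1 < M.rank → c M = 0) ∧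
            ∀ g : Matrix.GeneralLinearGroup (Fin 3) (ZMod p), f g =
              ∑ M : Matrix (Fin 3) (Fin 3) (ZMod p), c M * ZMod.stdAddChar
                (Matrix.trace (M * (g : Matrix (Fin 3) (Fin 3) (ZMod p))))},
        (χ 1).re ^ (2 + ε)) <
        ((Nat.card H₁ * Nat.card H₂ * Nat.card H₃ : ℕ) : ℝ) ^ ((2 + ε) / 3) := by
  rintro ⟨H₁, H₂, H₃, htpp, hdesign, hlt⟩
  rcases hp' with h | h
  · exact no_levelOne_witness_three_sixtyseven h hε hε1 htpp hdesign hlt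
  · exact no_levelOne_witness_three_seventyone h hε hε1 htpp hdesign hlt

end LevelOneEpsilonCellsFour

end Summit.MatrixMultiplication.MatrixMultiplication.Theorems.SubgroupIdentityDesigns.Negative
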